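import Mathlib.Analysis.Convex.Caratheodory
import Literature.Geometry.DiscreteGeometry.ConvexHullFacets
import Literature.Geometry.DiscreteGeometry.SphericalCodeHemisphere

/-!
# Link cones cover — the facet reduction (crux `SquareWellLayerCake.GapTwelveToBarlow`, line `Sketch`)

Stub `stub_linkConesCover` (four-deep all-Good ⇒ every site at distance in `(1, 2)` from `x i`
lies in the closed cone over a bonded closed 4-walk of the link of `i`) is reduced to a statement
about the FACES of the link polytope `conv {x l − x i : l ∈ link i}`:

* `exists_inner_neg_of_link`, `zero_mem_interior_convexHull_link` — twelve vectors of norm in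
  `[55/57, 1]`, pairwise `≥ 55/57` apart, make pairwise angles `≥ 57.69°` (normalised inner
  products `≤ 2·(0.876)² − 1`), so by the cap-packing bound in a hemisphere
  (`exists_inner_neg_of_twelve`) they meet every open hemisphere and `0` is in the interior of
  their convex hull;
* `exists_facet_triple` — Minkowski–Weyl (`argmaxCone_facetNormals_eq`: every `y` lies in the cone
  over some facet) + Carathéodory in the facet plane: every `y ≠ 0` is a nonnegative combination of
  at most three tight points of one facet normal;
* `linkConesCover_of_facetTriangleCones` — hence the stub follows from **FacetTriangleCones**:
  the closed cone over any three distinct link sites on a supporting plane `⟪n, · − x i⟫ = 1`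
  (`⟪n, x l − x i⟫ ≤ 1` on the link) is covered pointwise by cones over bonded closed 4-walks;
* `linkConesCover_of_goodFacets` (the registered anchor) — in particular from **GoodFacets**:
  any three distinct link sites on such a supporting plane span at least two bonds (pairs at
  distance `≤ 1`) — i.e. every face of the link polytope is a bonded triangle, a triangle with two
  bonded sides, or a quadrilateral with bonded boundary 4-cycle; the cone over such a triple is
  the cone of the bonded closed 4-walk `a b c b`.
-/

noncomputable section

namespace Summit.AtomisticToContinuum.Crystallization.Theorems.SquareWellLayerCakeGapTwelveToBarlow

open Real RealInnerProductSpace Metric Set Module Finset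
open Literature.Geometry.DiscreteGeometry

/-- **Angular separation of link vectors.** Two vectors of norm in `[55/57, 1]` at distance
`≥ 55/57` have normalised inner product `≤ 2·(876/1000)² − 1 = 0.534752` (the extreme case is two
unit vectors at distance `55/57`: `1 − (55/57)²/2 = 0.53447…`). -/
theorem inner_normalize_le_of_link {u v : EuclideanSpace ℝ (Fin 3)} (hu1 : ‖u‖ ≤ 1)
    (hu0 : (55 : ℝ) / 57 ≤ ‖u‖) (hv1 : ‖v‖ ≤ 1) (hv0 : (55 : ℝ) / 57 ≤ ‖v‖)
    (huv : (55 : ℝ) / 57 ≤ ‖u - v‖) :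
    inner ℝ (‖u‖⁻¹ • u) (‖v‖⁻¹ • v) ≤ 2 * ((876 : ℝ) / 1000) ^ 2 - 1 := by
  have hu : 0 < ‖u‖ := by linarith
  have hv : 0 < ‖v‖ := by linarith
  have hpol : inner ℝ u v = (‖u‖ ^ 2 + ‖v‖ ^ 2 - ‖u - v‖ ^ 2) / 2 := by
    rw [norm_sub_sq_real]; ring
  have hd2 : ((55 : ℝ) / 57) ^ 2 ≤ ‖u - v‖ ^ 2 := pow_le_pow_left₀ (by norm_num) huv 2
  have key : inner ℝ u v ≤ (2 * ((876 : ℝ) / 1000) ^ 2 - 1) * (‖u‖ * ‖v‖) := by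
    rw [hpol]
    nlinarith [mul_nonneg (sub_nonneg.2 hu1) (sub_nonneg.2 hu0),
      mul_nonneg (sub_nonneg.2 hv1) (sub_nonneg.2 hv0),
      mul_nonneg (sub_nonneg.2 hu1) (sub_nonneg.2 hv1)]
  rw [real_inner_smul_left, real_inner_smul_right, ← mul_assoc, ← mul_inv,
    inv_mul_le_iff₀ (mul_pos hu hv)]
  linarith

/-- **Twelve link directions meet every open hemisphere.** Twelve vectors of norm in `[55/57, 1]`,
pairwise at distance `≥ 55/57`, have one at negative inner product with any given `w ≠ 0`
(cap-packing bound `exists_inner_neg_of_twelve` at `c = 0.876` applied to the normalised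
vectors). -/
theorem exists_inner_neg_of_link {X : Finset (EuclideanSpace ℝ (Fin 3))} (hX : X.card = 12)
    (h1 : ∀ u ∈ X, ‖u‖ ≤ 1) (h0 : ∀ u ∈ X, (55 : ℝ) / 57 ≤ ‖u‖)
    (hsep : ∀ u ∈ X, ∀ v ∈ X, u ≠ v → (55 : ℝ) / 57 ≤ ‖u - v‖)
    {w : EuclideanSpace ℝ (Fin 3)} (hw : w ≠ 0) : ∃ u ∈ X, inner ℝ w u < 0 := by
  classical
  have hnorm : ∀ u ∈ X, 0 < ‖u‖ := fun u hu => by linarith [h0 u hu]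
  have hunit : ∀ u ∈ X, ‖‖u‖⁻¹ • u‖ = 1 := fun u hu => by
    rw [norm_smul, norm_inv, norm_norm, inv_mul_cancel₀ (hnorm u hu).ne']
  have hsepU : ∀ u ∈ X, ∀ v ∈ X, u ≠ v →
      inner ℝ (‖u‖⁻¹ • u) (‖v‖⁻¹ • v) ≤ 2 * ((876 : ℝ) / 1000) ^ 2 - 1 :=
    fun u hu v hv huv =>
      inner_normalize_le_of_link (h1 u hu) (h0 u hu) (h1 v hv) (h0 v hv) (hsep u hu v hv huv)
  have hinj : Set.InjOn (fun u : EuclideanSpace ℝ (Fin 3) => ‖u‖⁻¹ • u) ↑X := by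
    intro u hu v hv heq
    by_contra hne
    have h := hsepU u (Finset.mem_coe.1 hu) v (Finset.mem_coe.1 hv) hne
    simp only at heq
    rw [heq, real_inner_self_eq_norm_sq, hunit v (Finset.mem_coe.1 hv)] at h
    norm_num at h
  set U : Finset (EuclideanSpace ℝ (Fin 3)) := X.image fun u => ‖u‖⁻¹ • u with hU
  have hU1 : ∀ z ∈ U, ‖z‖ = 1 := by
    intro z hz
    obtain ⟨u, hu, rfl⟩ := Finset.mem_image.1 hz
    exact hunit u hu
  have hUcard : U.card = 12 := by rw [hU, Finset.card_image_of_injOn hinj, hX]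
  have hsepU' : ∀ z ∈ U, ∀ z' ∈ U, z ≠ z' → inner ℝ z z' ≤ 2 * ((876 : ℝ) / 1000) ^ 2 - 1 := by
    intro z hz z' hz' hne
    obtain ⟨u, hu, rfl⟩ := Finset.mem_image.1 hz
    obtain ⟨v, hv, rfl⟩ := Finset.mem_image.1 hz'
    exact hsepU u hu v hv fun h => hne (by rw [h])
  have hsqrt : Real.sqrt (1 - ((876 : ℝ) / 1000) ^ 2) < 488 / 1000 := by
    rw [Real.sqrt_lt' (by norm_num)]; norm_num
  obtain ⟨z, hz, hzw⟩ := exists_inner_neg_of_twelve hU1 hUcard (c := 876 / 1000) (by norm_num)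
    (by norm_num) (by linarith) hsepU' hw
  obtain ⟨u, hu, rfl⟩ := Finset.mem_image.1 hz
  refine ⟨u, hu, ?_⟩
  rw [real_inner_smul_right] at hzw
  rcases mul_neg_iff.1 hzw with h | h
  · exact h.2
  · exact absurd h.1 (not_lt.2 (inv_nonneg.2 (norm_nonneg _)))

/-- **The centre is interior to the link polytope**: for twelve vectors as above, `0` lies in
the interior of their convex hull. -/
theorem zero_mem_interior_convexHull_link {X : Finset (EuclideanSpace ℝ (Fin 3))}
    (hX : X.card = 12) (h1 : ∀ u ∈ X, ‖u‖ ≤ 1) (h0 : ∀ u ∈ X, (55 : ℝ) / 57 ≤ ‖u‖)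
    (hsep : ∀ u ∈ X, ∀ v ∈ X, u ≠ v → (55 : ℝ) / 57 ≤ ‖u - v‖) :
    (0 : EuclideanSpace ℝ (Fin 3)) ∈
      interior (convexHull ℝ (X : Set (EuclideanSpace ℝ (Fin 3)))) :=
  zero_mem_interior_convexHull_of_forall_exists_inner_neg
    (by rw [← Finset.card_pos, hX]; norm_num)
    fun _ hv => exists_inner_neg_of_link hX h1 h0 hsep hv

/-- **Facet triangle (Minkowski–Weyl + planar Carathéodory).** If `0` is interior to `conv X`
in `ℝ³`, every `y` is a nonnegative combination of at most three points of the tight set of one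
facet normal `c` of `conv X` (the ray of `y` leaves `conv X` through the facet of `c`;
Carathéodory in the facet plane `⟪c, ·⟫ = 1`, whose affinely independent subsets have `≤ 3`
points). -/
theorem exists_facet_triple {X : Finset (EuclideanSpace ℝ (Fin 3))}
    (h0 : (0 : EuclideanSpace ℝ (Fin 3)) ∈
      interior (convexHull ℝ (X : Set (EuclideanSpace ℝ (Fin 3)))))
    (y : EuclideanSpace ℝ (Fin 3)) :
    ∃ c ∈ facetNormals X, ∃ t : Finset (EuclideanSpace ℝ (Fin 3)), t ⊆ tightSet X c ∧ t.card ≤ 3 ∧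
      ∃ w : EuclideanSpace ℝ (Fin 3) → ℝ, (∀ z ∈ t, 0 ≤ w z) ∧ y = ∑ z ∈ t, w z • z := by
  classical
  obtain ⟨c, hc, hyc⟩ := exists_mem_argmaxCone (facetNormals X) (facetNormals_nonempty h0) y
  rw [argmaxCone_facetNormals_eq h0 hc] at hyc
  obtain ⟨s, hs, p, hp, rfl⟩ := hyc
  rw [convexHull_eq_union] at hp
  simp only [Set.mem_iUnion] at hp
  obtain ⟨t, hts, hai, hpt⟩ := hp
  have hts' : t ⊆ tightSet X c := Finset.coe_subset.1 hts
  -- `t` is nonempty, so `c ≠ 0`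
  obtain ⟨z₀, hz₀⟩ : t.Nonempty := by
    by_contra h
    rw [Finset.not_nonempty_iff_eq_empty] at h
    rw [h, Finset.coe_empty, convexHull_empty] at hpt
    exact hpt
  have hc0 : c ≠ 0 := by
    intro h
    have := (mem_tightSet.1 (hts' hz₀)).2
    rw [h, inner_zero_left] at this
    exact zero_ne_one this
  -- planarity: `card t ≤ 3`
  have hcard : t.card ≤ 3 := by
    have h1 := hai.card_le_finrank_succ
    rw [Fintype.card_coe, Subtype.range_coe_subtype, Finset.setOf_mem] at h1
    have h2 : vectorSpan ℝ (t : Set (EuclideanSpace ℝ (Fin 3))) ≤ (ℝ ∙ c)ᗮ := by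
      rw [vectorSpan_def, Submodule.span_le]
      rintro _ ⟨a, ha, b, hb, rfl⟩
      rw [SetLike.mem_coe, Submodule.mem_orthogonal_singleton_iff_inner_right]
      show inner ℝ c (a - b) = 0
      rw [inner_sub_right, (mem_tightSet.1 (hts' ha)).2, (mem_tightSet.1 (hts' hb)).2, sub_self]
    have h3 := Submodule.finrank_mono h2
    haveI : Fact (finrank ℝ (EuclideanSpace ℝ (Fin 3)) = 2 + 1) :=
      ⟨by rw [finrank_euclideanSpace_fin]⟩
    have h4 : finrank ℝ (ℝ ∙ c)ᗮ = 2 := Submodule.finrank_orthogonal_span_singleton hc0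
    omega
  obtain ⟨w, hw0, -, hwp⟩ := Finset.mem_convexHull'.1 hpt
  refine ⟨c, hc, t, hts', hcard, fun z => s * w z, fun z hz => mul_nonneg hs (hw0 z hz), ?_⟩
  rw [← hwp, Finset.smul_sum]
  simp_rw [smul_smul]

/-- A bonded 2-path `a – b – d` of link sites carrying `y` in its closed cone puts `y` in the
cone over the bonded closed 4-walk `a b d b` (the shape of the conclusion of
`stub_linkConesCover`). -/
theorem linkCone_of_two_bonds {N : ℕ} {x : Fin N → EuclideanSpace ℝ (Fin 3)} {i a b d : Fin N}
    {y : EuclideanSpace ℝ (Fin 3)}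
    (ha : a ≠ i ∧ dist (x i) (x a) ≤ 1) (hb : b ≠ i ∧ dist (x i) (x b) ≤ 1)
    (hd : d ≠ i ∧ dist (x i) (x d) ≤ 1) (hab : dist (x a) (x b) ≤ 1) (hbd : dist (x b) (x d) ≤ 1)
    {α β γ : ℝ} (hα : 0 ≤ α) (hβ : 0 ≤ β) (hγ : 0 ≤ γ)
    (hy : y = α • (x a - x i) + β • (x b - x i) + γ • (x d - x i)) :
    ∃ a b c d : Fin N, a ≠ i ∧ b ≠ i ∧ c ≠ i ∧ d ≠ i ∧ dist (x i) (x a) ≤ 1 ∧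
      dist (x i) (x b) ≤ 1 ∧ dist (x i) (x c) ≤ 1 ∧ dist (x i) (x d) ≤ 1 ∧ dist (x a) (x b) ≤ 1 ∧
      dist (x b) (x c) ≤ 1 ∧ dist (x c) (x d) ≤ 1 ∧ dist (x d) (x a) ≤ 1 ∧ ∃ α β γ δ : ℝ,
      0 ≤ α ∧ 0 ≤ β ∧ 0 ≤ γ ∧ 0 ≤ δ ∧
      y = α • (x a - x i) + β • (x b - x i) + γ • (x c - x i) + δ • (x d - x i) :=
  ⟨a, b, d, b, ha.1, hb.1, hd.1, hb.1, ha.2, hb.2, hd.2, hb.2, hab, hbd, by rwa [dist_comm],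
    by rwa [dist_comm], α, β, γ, 0, hα, hβ, hγ, le_rfl, by rw [hy, zero_smul, add_zero]⟩

/-- **LINK CONES COVER, reduced to the triangles of the faces of the link polytope** (the weakest
form of the reduction).  For a four-deep Good site `i` (only `Good i` is used), assume
**FacetTriangleCones**: for every `n` with `⟪n, x l − x i⟫ ≤ 1` on the link of `i` and any three
distinct link sites `a, b, c` on the supporting plane `⟪n, · − x i⟫ = 1`, every point of the
closed cone over `a, b, c` lies in the closed cone over some bonded closed 4-walk of the link.
Then every site `j` with `1 < dist (x i) (x j) < 2` lies in the closed cone over a bonded closed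
4-walk of the link (verbatim conclusion of `stub_linkConesCover`).  Proof:
`0 ∈ interior conv(link − x i)` (twelve `57.7°`-separated directions meet every open hemisphere),
so `x j − x i` is in the cone over a facet, hence (Carathéodory in the facet plane) a nonnegative
combination of `≤ 3` tight link vectors; pad to three distinct tight sites (a facet has `≥ 3`). -/
theorem linkConesCover_of_facetTriangleCones :
    ∀ (N : ℕ) (x : Fin N → EuclideanSpace ℝ (Fin 3)) (i : Fin N),
      (∀ l : Fin N, dist (x i) (x l) ≤ 4 →
        ((∀ j' : Fin N, dist (x l) (x j') ≤ 11 / 10 → ∀ k : Fin N, k ≠ j' →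
            (55 : ℝ) / 57 ≤ dist (x j') (x k)) ∧
          (Finset.univ.filter fun j' : Fin N => j' ≠ l ∧ dist (x l) (x j') ≤ 1).card = 12 ∧
          (Finset.univ.filter fun j' : Fin N => j' ≠ l ∧ dist (x l) (x j') ≤ 11 / 10).card ≤ 12)) →
      (∀ (n : EuclideanSpace ℝ (Fin 3)) (a b c : Fin N) (α β γ : ℝ),
        (∀ l : Fin N, l ≠ i → dist (x i) (x l) ≤ 1 → inner ℝ n (x l - x i) ≤ 1) →
        a ≠ i → b ≠ i → c ≠ i → a ≠ b → b ≠ c → a ≠ c →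
        dist (x i) (x a) ≤ 1 → dist (x i) (x b) ≤ 1 → dist (x i) (x c) ≤ 1 →
        inner ℝ n (x a - x i) = 1 → inner ℝ n (x b - x i) = 1 → inner ℝ n (x c - x i) = 1 →
        0 ≤ α → 0 ≤ β → 0 ≤ γ →
        ∃ p q r s : Fin N, p ≠ i ∧ q ≠ i ∧ r ≠ i ∧ s ≠ i ∧
          dist (x i) (x p) ≤ 1 ∧ dist (x i) (x q) ≤ 1 ∧ dist (x i) (x r) ≤ 1 ∧
          dist (x i) (x s) ≤ 1 ∧ dist (x p) (x q) ≤ 1 ∧ dist (x q) (x r) ≤ 1 ∧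
          dist (x r) (x s) ≤ 1 ∧ dist (x s) (x p) ≤ 1 ∧
          ∃ μ ν ρ σ : ℝ, 0 ≤ μ ∧ 0 ≤ ν ∧ 0 ≤ ρ ∧ 0 ≤ σ ∧
            α • (x a - x i) + β • (x b - x i) + γ • (x c - x i) =
              μ • (x p - x i) + ν • (x q - x i) + ρ • (x r - x i) + σ • (x s - x i)) →
      ∀ j : Fin N, 1 < dist (x i) (x j) → dist (x i) (x j) < 2 →
        ∃ a b c d : Fin N, a ≠ i ∧ b ≠ i ∧ c ≠ i ∧ d ≠ i ∧
          dist (x i) (x a) ≤ 1 ∧ dist (x i) (x b) ≤ 1 ∧ dist (x i) (x c) ≤ 1 ∧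
          dist (x i) (x d) ≤ 1 ∧ dist (x a) (x b) ≤ 1 ∧ dist (x b) (x c) ≤ 1 ∧
          dist (x c) (x d) ≤ 1 ∧ dist (x d) (x a) ≤ 1 ∧
          ∃ α β γ δ : ℝ, 0 ≤ α ∧ 0 ≤ β ∧ 0 ≤ γ ∧ 0 ≤ δ ∧
            x j - x i = α • (x a - x i) + β • (x b - x i) + γ • (x c - x i) + δ • (x d - x i) := by
  intro N x i hgood hcone j hj1 _hj2
  classical
  obtain ⟨hsep, hcard, -⟩ := hgood i (by rw [dist_self]; norm_num)
  -- the link `L` and its vectors `X`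
  set L : Finset (Fin N) := Finset.univ.filter fun l : Fin N => l ≠ i ∧ dist (x i) (x l) ≤ 1
    with hL
  have hmemL : ∀ l, l ∈ L ↔ l ≠ i ∧ dist (x i) (x l) ≤ 1 := fun l => by
    rw [hL, Finset.mem_filter]; exact ⟨fun h => h.2, fun h => ⟨Finset.mem_univ _, h⟩⟩
  have hsepL : ∀ l ∈ L, ∀ k : Fin N, k ≠ l → (55 : ℝ) / 57 ≤ dist (x l) (x k) :=
    fun l hl k hk => hsep l (by linarith [((hmemL l).1 hl).2]) k hk
  set X : Finset (EuclideanSpace ℝ (Fin 3)) := L.image fun l => x l - x i with hX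
  have hinj : Set.InjOn (fun l => x l - x i) ↑L := by
    intro l hl l' hl' h
    by_contra hne
    have h55 := hsepL l (Finset.mem_coe.1 hl) l' (Ne.symm hne)
    have : x l = x l' := sub_left_injective h
    rw [dist_eq_norm, this, sub_self, norm_zero] at h55
    norm_num at h55
  have hXcard : X.card = 12 := by rw [hX, Finset.card_image_of_injOn hinj]; exact hcard
  have hX1 : ∀ u ∈ X, ‖u‖ ≤ 1 := by
    intro u hu
    obtain ⟨l, hl, rfl⟩ := Finset.mem_image.1 hu
    rw [← dist_eq_norm, dist_comm]; exact ((hmemL l).1 hl).2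
  have hX0 : ∀ u ∈ X, (55 : ℝ) / 57 ≤ ‖u‖ := by
    intro u hu
    obtain ⟨l, hl, rfl⟩ := Finset.mem_image.1 hu
    rw [← dist_eq_norm, dist_comm]
    exact hsep i (by rw [dist_self]; norm_num) l ((hmemL l).1 hl).1
  have hXsep : ∀ u ∈ X, ∀ v ∈ X, u ≠ v → (55 : ℝ) / 57 ≤ ‖u - v‖ := by
    intro u hu v hv huv
    obtain ⟨l, hl, rfl⟩ := Finset.mem_image.1 hu
    obtain ⟨l', hl', rfl⟩ := Finset.mem_image.1 hv
    have hne : l' ≠ l := fun h => huv (by rw [h])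
    rw [sub_sub_sub_cancel_right, ← dist_eq_norm]
    exact hsepL l hl l' hne
  have h0 := zero_mem_interior_convexHull_link hXcard hX1 hX0 hXsep
  -- the facet of `x j - x i` and a Carathéodory triple on it
  obtain ⟨c, hc, t, hts, htcard, w, hw0, hyw⟩ := exists_facet_triple h0 (x j - x i)
  have hvalid : ∀ l : Fin N, l ≠ i → dist (x i) (x l) ≤ 1 → inner ℝ c (x l - x i) ≤ 1 :=
    fun l hl hdl =>
      (mem_facetNormals.1 hc).1 _ (Finset.mem_image.2 ⟨l, (hmemL l).2 ⟨hl, hdl⟩, rfl⟩)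
  have htight : ∀ z ∈ tightSet X c, ∃ l : Fin N, (l ≠ i ∧ dist (x i) (x l) ≤ 1) ∧
      inner ℝ c (x l - x i) = 1 ∧ x l - x i = z := by
    intro z hz
    obtain ⟨hzX, hz1⟩ := mem_tightSet.1 hz
    obtain ⟨l, hl, rfl⟩ := Finset.mem_image.1 hzX
    exact ⟨l, (hmemL l).1 hl, hz1, rfl⟩
  -- three distinct tight points carrying `x j - x i` in their cone suffice
  have key : ∀ a b d : EuclideanSpace ℝ (Fin 3), a ∈ tightSet X c → b ∈ tightSet X c →
      d ∈ tightSet X c → a ≠ b → b ≠ d → a ≠ d → ∀ α β γ : ℝ, 0 ≤ α → 0 ≤ β → 0 ≤ γ →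
      x j - x i = α • a + β • b + γ • d →
      ∃ a b c d : Fin N, a ≠ i ∧ b ≠ i ∧ c ≠ i ∧ d ≠ i ∧ dist (x i) (x a) ≤ 1 ∧
        dist (x i) (x b) ≤ 1 ∧ dist (x i) (x c) ≤ 1 ∧ dist (x i) (x d) ≤ 1 ∧ dist (x a) (x b) ≤ 1 ∧
        dist (x b) (x c) ≤ 1 ∧ dist (x c) (x d) ≤ 1 ∧ dist (x d) (x a) ≤ 1 ∧ ∃ α β γ δ : ℝ,
        0 ≤ α ∧ 0 ≤ β ∧ 0 ≤ γ ∧ 0 ≤ δ ∧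
        x j - x i = α • (x a - x i) + β • (x b - x i) + γ • (x c - x i) + δ • (x d - x i) := by
    intro a b d ha hb hd hab hbd had α β γ hα hβ hγ hy
    obtain ⟨la, hla, hla1, rfl⟩ := htight a ha
    obtain ⟨lb, hlb, hlb1, rfl⟩ := htight b hb
    obtain ⟨ld, hld, hld1, rfl⟩ := htight d hd
    have hab' : la ≠ lb := fun h => hab (by rw [h])
    have hbd' : lb ≠ ld := fun h => hbd (by rw [h])
    have had' : la ≠ ld := fun h => had (by rw [h])
    obtain ⟨p, q, r, s, hp, hq, hr, hs, hip, hiq, hir, his, hpq, hqr, hrs, hsp, μ, ν, ρ, σ,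
      hμ, hν, hρ, hσ, heq⟩ := hcone c la lb ld α β γ hvalid hla.1 hlb.1 hld.1 hab' hbd' had'
      hla.2 hlb.2 hld.2 hla1 hlb1 hld1 hα hβ hγ
    exact ⟨p, q, r, s, hp, hq, hr, hs, hip, hiq, hir, his, hpq, hqr, hrs, hsp, μ, ν, ρ, σ,
      hμ, hν, hρ, hσ, by rw [hy, heq]⟩
  -- a facet has at least three tight points
  have hthree : 3 ≤ (tightSet X c).card := by
    have := (mem_facetNormals.1 hc).finrank_le_card
    rwa [finrank_euclideanSpace_fin] at this
  -- case analysis on the size of the Carathéodory set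
  rcases Nat.lt_or_ge t.card 1 with h0t | h1t
  · -- `t = ∅`: then `x j = x i`, impossible
    have ht : t = ∅ := Finset.card_eq_zero.1 (by omega)
    rw [ht, Finset.sum_empty, sub_eq_zero] at hyw
    rw [hyw, dist_self] at hj1
    exact absurd hj1 (by norm_num)
  rcases Nat.lt_or_ge t.card 2 with h2t | h2t
  · -- `t = {a}`
    obtain ⟨a, rfl⟩ := (Finset.card_eq_one (s := t)).1 (by omega)
    rw [Finset.sum_singleton] at hyw
    have ha := hts (Finset.mem_singleton_self a)
    obtain ⟨la, hla, -, hxa⟩ := htight a ha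
    refine linkCone_of_two_bonds hla hla hla (by rw [dist_self]; norm_num)
      (by rw [dist_self]; norm_num) (hw0 a (Finset.mem_singleton_self a)) le_rfl le_rfl ?_
    rw [hyw, hxa, zero_smul, add_zero, add_zero]
  rcases Nat.lt_or_ge t.card 3 with h3t | h3t
  · -- `t = {a, b}`: add a third tight point
    obtain ⟨a, b, hab, rfl⟩ := (Finset.card_eq_two (s := t)).1 (by omega)
    obtain ⟨d, hd, hdt⟩ := Finset.exists_mem_notMem_of_card_lt_card
      (by omega : ({a, b} : Finset _).card < (tightSet X c).card)
    have hda : d ≠ a := fun h => hdt (by rw [h]; exact Finset.mem_insert_self _ _)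
    have hdb : d ≠ b := fun h =>
      hdt (by rw [h]; exact Finset.mem_insert_of_mem (Finset.mem_singleton_self _))
    rw [Finset.sum_pair hab] at hyw
    exact key a b d (hts (Finset.mem_insert_self _ _))
      (hts (Finset.mem_insert_of_mem (Finset.mem_singleton_self _))) hd hab hdb.symm hda.symm
      (w a) (w b) 0 (hw0 a (Finset.mem_insert_self _ _))
      (hw0 b (Finset.mem_insert_of_mem (Finset.mem_singleton_self _))) le_rfl
      (by rw [hyw, zero_smul, add_zero])
  · -- `t = {a, b, d}`
    obtain ⟨a, b, d, hab, had, hbd, rfl⟩ := (Finset.card_eq_three (s := t)).1 (by omega)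
    have ha : a ∈ ({a, b, d} : Finset _) := Finset.mem_insert_self _ _
    have hb : b ∈ ({a, b, d} : Finset _) :=
      Finset.mem_insert_of_mem (Finset.mem_insert_self _ _)
    have hd : d ∈ ({a, b, d} : Finset _) :=
      Finset.mem_insert_of_mem (Finset.mem_insert_of_mem (Finset.mem_singleton_self _))
    rw [Finset.sum_insert (by simp [hab, had]), Finset.sum_pair hbd] at hyw
    exact key a b d (hts ha) (hts hb) (hts hd) hab hbd had (w a) (w b) (w d) (hw0 a ha)
      (hw0 b hb) (hw0 d hd) (by rw [hyw, add_assoc])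

/-- **LINK CONES COVER, reduced to the faces of the link polytope** (the registered anchor).  For
a four-deep Good site `i` (only `Good i` is used), assume **GoodFacets**: for every `n` with
`⟪n, x l − x i⟫ ≤ 1` on the link of `i`, any three distinct link sites `a, b, c` on the supporting
plane `⟪n, · − x i⟫ = 1` span at least two bonds among `ab, bc, ca` — i.e. every face of the
link polytope is a bonded triangle, a triangle with two bonded sides, or a quadrilateral with
bonded boundary 4-cycle (as for the cubocta-, anticubocta- and `D5h`-links).  Then every site `j`
with `1 < dist (x i) (x j) < 2` lies in the closed cone over a bonded closed 4-walk of the link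
(verbatim conclusion of `stub_linkConesCover`): the two bonds make `a, b, c` a bonded 2-path,
whose cone is that of a closed 4-walk (`linkCone_of_two_bonds`), and
`linkConesCover_of_facetTriangleCones` applies. -/
theorem linkConesCover_of_goodFacets :
    ∀ (N : ℕ) (x : Fin N → EuclideanSpace ℝ (Fin 3)) (i : Fin N),
      (∀ l : Fin N, dist (x i) (x l) ≤ 4 →
        ((∀ j' : Fin N, dist (x l) (x j') ≤ 11 / 10 → ∀ k : Fin N, k ≠ j' →
            (55 : ℝ) / 57 ≤ dist (x j') (x k)) ∧
          (Finset.univ.filter fun j' : Fin N => j' ≠ l ∧ dist (x l) (x j') ≤ 1).card = 12 ∧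
          (Finset.univ.filter fun j' : Fin N => j' ≠ l ∧ dist (x l) (x j') ≤ 11 / 10).card ≤ 12)) →
      (∀ (n : EuclideanSpace ℝ (Fin 3)) (a b c : Fin N),
        (∀ l : Fin N, l ≠ i → dist (x i) (x l) ≤ 1 → inner ℝ n (x l - x i) ≤ 1) →
        a ≠ i → b ≠ i → c ≠ i → a ≠ b → b ≠ c → a ≠ c →
        dist (x i) (x a) ≤ 1 → dist (x i) (x b) ≤ 1 → dist (x i) (x c) ≤ 1 →
        inner ℝ n (x a - x i) = 1 → inner ℝ n (x b - x i) = 1 → inner ℝ n (x c - x i) = 1 →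
        (dist (x a) (x b) ≤ 1 ∧ dist (x b) (x c) ≤ 1) ∨ (dist (x b) (x c) ≤ 1 ∧ dist (x c) (x a) ≤ 1) ∨
          (dist (x c) (x a) ≤ 1 ∧ dist (x a) (x b) ≤ 1)) →
      ∀ j : Fin N, 1 < dist (x i) (x j) → dist (x i) (x j) < 2 →
        ∃ a b c d : Fin N, a ≠ i ∧ b ≠ i ∧ c ≠ i ∧ d ≠ i ∧
          dist (x i) (x a) ≤ 1 ∧ dist (x i) (x b) ≤ 1 ∧ dist (x i) (x c) ≤ 1 ∧
          dist (x i) (x d) ≤ 1 ∧ dist (x a) (x b) ≤ 1 ∧ dist (x b) (x c) ≤ 1 ∧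
          dist (x c) (x d) ≤ 1 ∧ dist (x d) (x a) ≤ 1 ∧
          ∃ α β γ δ : ℝ, 0 ≤ α ∧ 0 ≤ β ∧ 0 ≤ γ ∧ 0 ≤ δ ∧
            x j - x i = α • (x a - x i) + β • (x b - x i) + γ • (x c - x i) + δ • (x d - x i) := by
  intro N x i hgood hfacet
  refine linkConesCover_of_facetTriangleCones N x i hgood ?_
  intro n a b c α β γ hvalid hai hbi hci hab hbc hac hia hib hic hta htb htc hα hβ hγ
  rcases hfacet n a b c hvalid hai hbi hci hab hbc hac hia hib hic hta htb htc with h | h | h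
  · exact linkCone_of_two_bonds ⟨hai, hia⟩ ⟨hbi, hib⟩ ⟨hci, hic⟩ h.1 h.2 hα hβ hγ rfl
  · exact linkCone_of_two_bonds ⟨hbi, hib⟩ ⟨hci, hic⟩ ⟨hai, hia⟩ h.1 h.2 hβ hγ hα (by abel)
  · exact linkCone_of_two_bonds ⟨hci, hic⟩ ⟨hai, hia⟩ ⟨hbi, hib⟩ h.1 h.2 hγ hα hβ (by abel)

end Summit.AtomisticToContinuum.Crystallization.Theorems.SquareWellLayerCakeGapTwelveToBarlow

end
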